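import Literature.AlgebraicGeometry.GroupSchemes.IdealKernelLayerIso          -- ★ (θ-0)∕(R7): `exists_layerMap`, `comp_eq_one_of_pin`, `pinAction_comp_pinAction_eq_id`
import Literature.AlgebraicGeometry.GroupSchemes.CartierDualCharacterIso      -- ★ `AffineGroupScheme.mono_of_forall_comp_eq_one`
import Literature.AlgebraicGeometry.GroupSchemes.CartierDualLagrangian         -- ★ `AffineGroupScheme.isIso_of_isClosedImmersion_of_finrank_alg_eq`
import Mathlib.AlgebraicGeometry.Sites.Fpqc                                    -- Mathlib: flat + surjective + quasi-compact ⇒ effective epi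
import Mathlib.AlgebraicGeometry.Morphisms.Finite
import HarnessLib

/-!
# The layer ISOMORPHISM along a Serre cover `ψ : A → C` with kernel `A[𝔞]`: `C[𝔭] ≅ A[𝔭]` through the return map `ψ′_a`, `a ∈ 𝔞` of exact `𝔭`-valuation
# (any field; [Mumford 1970] §7 Thm. 4, [Tate 1997] (3.7), [Conrad 2004] §7)

Topic `Literature/AlgebraicGeometry/GroupSchemes`; namespace `Literature.AlgebraicGeometry.GroupSchemes.IdealKernelLayerIso`.  THEOREMS ONLY (no definition, no
named fact, no `instance`, no notation, no `sorry`).  Cell `hodgecm-mathlib` (D-0151), FLOOR 0, P6 «MOD programme» (crux hLiu418 = stmt-HodgeConjecture-24832,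
`--supports`, count-neutral): organ **(R8) «LAYER ISO ALONG A SERRE COVER»** of line L2 (socket `stub_DOWN`, organ `stub_LAYERISO`; A-p03 (g31) 02:35:26Z RECOGNITION
road, LA2-plan (g0) 02:31:16Z): DOWNSTAIRS, at the special fibre, the family Serre cover `ψ : univ_x̄ → (univ ⊗ 𝔞⁻¹)_x̄` and its return map `ψ′_a` (`ψ ≫ ψ′_a = ι(a)`) are
special fibres of GLOBAL homomorphisms (no reduction of composites), the kernel law `Ker ψ ⊇ A[𝔞]` holds at every base (★ α2a′), and the target is identified with
`univ_{θx̄}` by the reduced recognition isomorphism (★ (ν8d)); this file supplies the missing step, CHARACTERISTIC-FREE: for `a ∈ 𝔞` of exact `𝔭`-valuation (a cofactor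
`r ≡ 1 (𝔭)` with `r𝔞 ⊆ (a)`), the layer map of `ψ′_a` on the `𝔭`-layers is an ISOMORPHISM `C[𝔭] ≅ A[𝔭]` (equal ranks).  With `𝔭 ∤ 𝔞` this is the unit-scalar pair of ★ §5;
here `𝔭 ∣ 𝔞` is allowed (the layer map of `ψ` itself is then zero).  HC_CM is proved only modulo the printed citations (2 remaining named inputs hLiu418 24832, h413 24833) until
rung 0 closes; this file is generic and changes no count.

THE MATHEMATICS ([MumfordAV1970] §7 Thm. 4 p. 72: isogenies are fppf epimorphisms, homomorphisms killing the kernel descend; [Tate1997FiniteFlatGroupSchemes] (3.7):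
a closed subgroup scheme of the same order is everything; [Conrad2004GrossZagier] §7 Thm. 7.5: the Serre cover `A → A ⊗ 𝔞⁻¹` has kernel `A[𝔞]`).  Over a field `k`:
`A`, `C` group schemes with additive ∕ multiplicative ∕ unital families of endomorphisms `α`, `αC : 𝒪 → End` by homomorphisms; `ψ : A → C` an equivariant homomorphism,
FLAT, SURJECTIVE and QUASI-COMPACT, killing `A[𝔞]` (`(∀ a′ ∈ 𝔞, s ≫ α a′ = 1) → s ≫ ψ = 1` on all `T`-points); `ψ′ : C → A` with `ψ ≫ ψ′ = α a`; `r ∈ 𝒪` with `r𝔞 ⊆ (a)`.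
(§1) **`ψ′` KILLS ONLY `r`-TORSION-FREE POINTS: `t ≫ ψ′ = 1 ⇒ t ≫ αC r = 1`** for every `T`-point `t` of `C`: base-change the fppf epimorphism `ψ` along `t` to `p₁ : P → T`
(again flat surjective quasi-compact, hence an epimorphism) with `p₁ ≫ t = p₂ ≫ ψ`; then `p₂ ≫ α a = p₂ ≫ ψ ≫ ψ′ = p₁ ≫ t ≫ ψ′ = 1`, so `p₂ ≫ α r` is killed by `𝔞`
(`α a′ (α r ·) = α(a′r) = α(xa)`), hence by `ψ` (kernel law), and `p₁ ≫ (t ≫ αC r) = p₂ ≫ ψ ≫ αC r = (p₂ ≫ α r) ≫ ψ = 1 = p₁ ≫ 1` — cancel `p₁`.  (§2) With PINS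
`ιA : A[𝔭] ↪ A`, `ιC : C[𝔭] ↪ C` (homomorphic closed immersions with the kernel-of-`𝔭` universal property) and `r ≡ 1 (mod 𝔭)`, the layer map `φ` of `ψ′`
(`φ ≫ ιA = ιC ≫ ψ′`, ★ L1) has TRIVIAL KERNEL on all `T`-points (`t ≫ φ = 1 ⇒ t ≫ ιC` killed by `r` and by `𝔭 ∋ 1 - r r′`, hence `= 1`), so it is a monomorphism
(★ `mono_of_forall_comp_eq_one`), a closed immersion (finite + mono), and — the layers being finite of the SAME RANK — an isomorphism (★ `isIso_of_isClosedImmersion_of_finrank_alg_eq`),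
a homomorphism both ways and equivariant both ways (★ L2, L3).

* §1 `comp_eq_one_of_comp_returnMap_eq_one` (the fppf-local lifting argument, any base field, no pins);
* §2 **`exists_layerIso_of_serreCover`** (the layer iso `φ : GC ≅ GA` over `ψ′`, homomorphisms, equivariances).
* §3 (ED. 2) `pin_transport_of_iso`, **`exists_layerIso_of_serreCover_of_iso`** — the same with the source pinned THROUGH an equivariant isomorphism `u : A ⟶ A″`
  (the reduced recognition iso `ū` of L2), landing in `GC ≅ GA″`.

## References
* [MumfordAV1970] D. Mumford, *Abelian Varieties* (1970), §7 Thm. 4 (p. 72).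
* [Tate1997FiniteFlatGroupSchemes] J. Tate, *Finite flat group schemes* (1997), (1.6)–(1.7) p. 122, (3.7).
* [Conrad2004GrossZagier] B. Conrad, *Gross–Zagier revisited*, MSRI Publ. 49 (2004), §7 (Thm. 7.5).
-/

set_option autoImplicit false

-- Mathlib's `Over`/`Scheme` APIs and the transported group structures are stated across semireducible wrappers (as in ★ `GroupSchemes/*`).
set_option backward.isDefEq.respectTransparency false

universe u

open CategoryTheory CategoryTheory.Limits MonoidalCategory CartesianMonoidalCategory AlgebraicGeometry

noncomputable section

namespace Literature.AlgebraicGeometry.GroupSchemes.IdealKernelLayerIso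

open scoped MonObj Obj
open IdealKernelLayerMap AffineGroupScheme
open Literature.AlgebraicGeometry.Motives

variable {k : Type u} [Field k] {O : Type*} [CommRing O] {σ : Type*} [SetLike σ O]

/-! ## §1 The return map `ψ′` kills only points killed by the cofactor `r` -/

/-- **`t ≫ ψ′ = 1 ⇒ t ≫ αC r = 1`** for a flat surjective quasi-compact equivariant homomorphism `ψ : A → C` killing `A[𝔞]`, a return map `ψ′` with `ψ ≫ ψ′ = α a`, and a
cofactor `r` with `r𝔞 ⊆ (a)` (fppf-local lifting along `ψ`: the base change `p₁ : A ×_C T → T` is an epimorphism). [cite: MumfordAV1970, §7 Thm. 4 (p. 72)]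
[cite: Conrad2004GrossZagier, §7 (Thm. 7.5)] -/
theorem comp_eq_one_of_comp_returnMap_eq_one {A C : SchemeOver k} [GrpObj A] [GrpObj C]
    (𝔞 : σ) (α : O → (A ⟶ A)) (αC : O → (C ⟶ C)) (hαhom : ∀ x, IsMonHom (α x)) (hαmul : ∀ x y, α (x * y) = α y ≫ α x)
    (ψ : A ⟶ C) [IsMonHom ψ] [Flat ψ.left] [Surjective ψ.left] [QuasiCompact ψ.left] (hψ : ∀ x, α x ≫ ψ = ψ ≫ αC x)
    (hker : ∀ ⦃T : SchemeOver k⦄ (s : T ⟶ A), (∀ a' ∈ 𝔞, s ≫ α a' = 1) → s ≫ ψ = 1)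
    {a r : O} (hr : ∀ a' ∈ 𝔞, ∃ x : O, a' * r = x * a) (ψ' : C ⟶ A) (hψψ' : ψ ≫ ψ' = α a)
    ⦃T : SchemeOver k⦄ (t : T ⟶ C) (ht : t ≫ ψ' = 1) : t ≫ αC r = 1 := by
  -- the base change of `ψ` along `t`, as a square in `SchemeOver k`
  let P : SchemeOver k := Over.mk (pullback.fst t.left ψ.left ≫ T.hom)
  let p₁ : P ⟶ T := Over.homMk (pullback.fst t.left ψ.left) rfl
  have hw : pullback.snd t.left ψ.left ≫ A.hom = pullback.fst t.left ψ.left ≫ T.hom := by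
    rw [← Over.w ψ, ← Category.assoc, ← pullback.condition, Category.assoc, Over.w t]
  let p₂ : P ⟶ A := Over.homMk (pullback.snd t.left ψ.left) hw
  have hsq : p₁ ≫ t = p₂ ≫ ψ := Over.OverMorphism.ext (pullback.condition)
  -- `p₁` is an epimorphism (flat + surjective + quasi-compact base change of `ψ`)
  haveI : Epi p₁.left := by
    change Epi (pullback.fst t.left ψ.left)
    infer_instance
  haveI : Epi p₁ := Over.epi_of_epi_left p₁
  -- `p₂ ≫ α a = 1`
  haveI := hαhom
  have h2 : p₂ ≫ α a = 1 := by
    rw [← hψψ', ← Category.assoc, ← hsq, Category.assoc, ht, MonObj.comp_one]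
  -- `p₂ ≫ α r` is killed by `𝔞`, hence by `ψ`
  have h3 : (p₂ ≫ α r) ≫ ψ = 1 := by
    refine hker _ fun a' ha' => ?_
    obtain ⟨x, hx⟩ := hr a' ha'
    rw [Category.assoc, ← hαmul, hx, hαmul, ← Category.assoc, h2, MonObj.one_comp]
  -- cancel the epimorphism `p₁`
  rw [← cancel_epi p₁, ← Category.assoc, hsq, Category.assoc, ← hψ, ← Category.assoc, h3, MonObj.comp_one]

/-! ## §2 The layer isomorphism along the cover -/

/-- **THE LAYER ISO ALONG A SERRE COVER (one `obtain`, any field).**  `A`, `C` group schemes over `k` with additive ∕ multiplicative ∕ unital families `α`, `αC : 𝒪 → End`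
by homomorphisms; PINS `ιA : GA ↪ A`, `ιC : GC ↪ C` (homomorphic closed immersions with the kernel-of-`𝔭` universal property; `GA`, `GC` affine with finite
coordinate algebras OF THE SAME RANK) and actions-on-the-pins `βA`, `βC`; an equivariant homomorphism `ψ : A → C`, flat surjective quasi-compact, killing `A[𝔞]` on all
`T`-points; a return homomorphism `ψ′ : C → A`, equivariant, with `ψ ≫ ψ′ = α a`; a cofactor `r` with `r𝔞 ⊆ (a)` and `r r′ = 1 + q`, `q ∈ 𝔭`.  THEN there is an isomorphism
`φ : GC ≅ GA` OVER `ψ′` (`φ.hom ≫ ιA = ιC ≫ ψ′`), homomorphisms both ways, with `βC x ≫ φ.hom = φ.hom ≫ βA x` and `βA x ≫ φ.inv = φ.inv ≫ βC x`.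
[cite: MumfordAV1970, §7 Thm. 4 (p. 72)] [cite: Tate1997FiniteFlatGroupSchemes, (1.6)–(1.7) p. 122, (3.7)] [cite: Conrad2004GrossZagier, §7 (Thm. 7.5)] -/
theorem exists_layerIso_of_serreCover {A C GA GC : SchemeOver k} [GrpObj A] [GrpObj C] [GrpObj GA] [GrpObj GC]
    [IsAffine GA.left] [IsAffine GC.left] [Module.Finite k (Alg GA)] [Module.Finite k (Alg GC)] [IsFinite GA.hom] [IsFinite GC.hom]
    (𝔭 𝔞 : σ) (α : O → (A ⟶ A)) (αC : O → (C ⟶ C)) (hαhom : ∀ x, IsMonHom (α x)) (hChom : ∀ x, IsMonHom (αC x))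
    (hαmul : ∀ x y, α (x * y) = α y ≫ α x)
    (hCmul : ∀ x y, αC (x * y) = αC y ≫ αC x) (hCadd : ∀ x y, αC (x + y) = αC x * αC y) (hCone : αC 1 = 𝟙 C)
    (ιA : GA ⟶ A) (ιC : GC ⟶ C) (hιA : IsMonHom ιA ∧ IsClosedImmersion ιA.left) (hιC : IsMonHom ιC ∧ IsClosedImmersion ιC.left)
    (hkerA : ∀ ⦃T : SchemeOver k⦄ (t : T ⟶ A), (∀ x ∈ 𝔭, t ≫ α x = 1) ↔ ∃ s : T ⟶ GA, s ≫ ιA = t)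
    (hkerC : ∀ ⦃T : SchemeOver k⦄ (t : T ⟶ C), (∀ x ∈ 𝔭, t ≫ αC x = 1) ↔ ∃ s : T ⟶ GC, s ≫ ιC = t)
    (βA : O → (GA ⟶ GA)) (hβA : ∀ x, βA x ≫ ιA = ιA ≫ α x) (βC : O → (GC ⟶ GC)) (hβC : ∀ x, βC x ≫ ιC = ιC ≫ αC x)
    (hrank : Module.finrank k (Alg GC) = Module.finrank k (Alg GA))
    (ψ : A ⟶ C) [IsMonHom ψ] [Flat ψ.left] [Surjective ψ.left] [QuasiCompact ψ.left] (hψ : ∀ x, α x ≫ ψ = ψ ≫ αC x)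
    (hker : ∀ ⦃T : SchemeOver k⦄ (s : T ⟶ A), (∀ a' ∈ 𝔞, s ≫ α a' = 1) → s ≫ ψ = 1)
    {a r r' : O} (hr : ∀ a' ∈ 𝔞, ∃ x : O, a' * r = x * a) (hrr' : ∃ q ∈ 𝔭, r * r' = 1 + q)
    (ψ' : C ⟶ A) [IsMonHom ψ'] (hψ' : ∀ x, αC x ≫ ψ' = ψ' ≫ α x) (hψψ' : ψ ≫ ψ' = α a) :
    ∃ φ : GC ≅ GA, φ.hom ≫ ιA = ιC ≫ ψ' ∧ IsMonHom φ.hom ∧ IsMonHom φ.inv ∧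
      (∀ x, βC x ≫ φ.hom = φ.hom ≫ βA x) ∧ (∀ x, βA x ≫ φ.inv = φ.inv ≫ βC x) := by
  haveI := hιA.1
  haveI := hιC.1
  haveI : IsClosedImmersion ιA.left := hιA.2
  haveI : IsClosedImmersion ιC.left := hιC.2
  haveI : Mono ιA := Over.mono_of_mono_left ιA
  haveI : Mono ιC := Over.mono_of_mono_left ιC
  haveI := hChom
  -- the layer map of `ψ′`
  obtain ⟨φ, hφ, hmon, hβφ, hkill, -⟩ := exists_layerMap 𝔭 αC α ιC ιA hkerC hkerA βC hβC βA hβA ψ' hψ'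
  haveI := hmon
  -- trivial kernel on all `T`-points
  have htriv : ∀ ⦃T : SchemeOver k⦄ (y : T ⟶ GC), y ≫ φ = 1 → y = 1 := by
    intro T y hy
    have h1 : (y ≫ ιC) ≫ ψ' = 1 := by rw [Category.assoc]; exact (hkill y).mp hy
    have h2 : (y ≫ ιC) ≫ αC r = 1 := comp_eq_one_of_comp_returnMap_eq_one 𝔞 α αC hαhom hαmul ψ hψ hker hr ψ' hψψ' (y ≫ ιC) h1
    obtain ⟨q, hq, hq'⟩ := hrr'
    have h3 : (y ≫ ιC) ≫ αC q = 1 := by rw [Category.assoc, comp_eq_one_of_pin 𝔭 αC ιC hkerC hq, MonObj.comp_one]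
    have h4 : (y ≫ ιC) ≫ αC (r' * r) = y ≫ ιC := by
      rw [mul_comm, hq', hCadd, hCone, MonObj.comp_mul, Category.comp_id, h3, mul_one]
    have h5 : y ≫ ιC = 1 := by
      rw [← h4, hCmul, ← Category.assoc, h2, MonObj.one_comp]
    rw [← cancel_mono ιC, h5, MonObj.one_comp]
  haveI : Mono φ := mono_of_forall_comp_eq_one φ htriv
  -- finite + mono ⇒ closed immersion; equal ranks ⇒ isomorphism
  haveI : IsFinite φ.left := by
    have h : IsFinite (φ.left ≫ GA.hom) := by rw [Over.w φ]; infer_instance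
    exact IsFinite.of_comp φ.left GA.hom
  haveI : IsClosedImmersion φ.left := (IsClosedImmersion.iff_isFinite_and_mono φ.left).mpr ⟨inferInstance, inferInstance⟩
  haveI : IsIso φ := isIso_of_isClosedImmersion_of_finrank_alg_eq φ hrank
  refine ⟨asIso φ, hφ, hmon, inferInstance, hβφ, fun x => ?_⟩
  change βA x ≫ inv φ = inv φ ≫ βC x
  refine (IsIso.eq_inv_comp φ).mpr ?_
  rw [← Category.assoc, ← hβφ x, Category.assoc, IsIso.hom_inv_id, Category.comp_id]

/-! ## §3 (ED. 2, appended; §1–§2 token-identical) The same with the pin on the cover՚s SOURCE transported along an equivariant isomorphism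
In line L2 the source of the special-fibre cover `ψ = (ψ′_Q)_{x̄} : (univ ⊗ 𝔟)_{x̄} → univ_{x̄}` carries no dock of its own: its `𝔭`-layer is PINNED through the reduced
recognition isomorphism `ū : (univ ⊗ 𝔟)_{x̄} ≅ univ_{x̄″}` (★ (ν8d)) by the dock at `x̄″`.  Transporting a pin along an equivariant isomorphism keeps the kernel-of-`𝔭`
property, so §2 applies and lands directly in `G₀(x̄) ≅ G₀(x̄″)`. -/

omit [CommRing O] in
/-- **PIN TRANSPORT ALONG AN EQUIVARIANT ISOMORPHISM**: if `u : A ⟶ A″` is an isomorphism of group schemes with `α x ≫ u = u ≫ α″ x` and `ιA″ : GA″ ↪ A″` is a pin for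
`α″` (homomorphic closed immersion with the kernel-of-`𝔭` universal property, action `βA″` over `α″`), then `ιA″ ≫ u⁻¹ : GA″ ↪ A` is a pin for `α` with the same
action `βA″`. [cite: Tate1997FiniteFlatGroupSchemes, (1.6)–(1.7) p. 122] -/
theorem pin_transport_of_iso {A A'' GA'' : SchemeOver k} [GrpObj A] [GrpObj A''] [GrpObj GA'']
    (𝔭 : σ) (α : O → (A ⟶ A)) (α'' : O → (A'' ⟶ A''))
    (u : A ⟶ A'') [IsMonHom u] [IsIso u] (hu : ∀ x, α x ≫ u = u ≫ α'' x)
    (ιA'' : GA'' ⟶ A'') (hιA'' : IsMonHom ιA'' ∧ IsClosedImmersion ιA''.left)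
    (hkerA'' : ∀ ⦃T : SchemeOver k⦄ (t : T ⟶ A''), (∀ x ∈ 𝔭, t ≫ α'' x = 1) ↔ ∃ s : T ⟶ GA'', s ≫ ιA'' = t)
    (βA'' : O → (GA'' ⟶ GA'')) (hβA'' : ∀ x, βA'' x ≫ ιA'' = ιA'' ≫ α'' x) :
    (IsMonHom (ιA'' ≫ inv u) ∧ IsClosedImmersion (ιA'' ≫ inv u).left) ∧
      (∀ ⦃T : SchemeOver k⦄ (t : T ⟶ A), (∀ x ∈ 𝔭, t ≫ α x = 1) ↔ ∃ s : T ⟶ GA'', s ≫ (ιA'' ≫ inv u) = t) ∧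
      (∀ x, βA'' x ≫ (ιA'' ≫ inv u) = (ιA'' ≫ inv u) ≫ α x) := by
  haveI := hιA''.1
  haveI : IsClosedImmersion ιA''.left := hιA''.2
  haveI : IsMonHom (asIso u).inv := inferInstance
  haveI : IsMonHom (inv u) := by rw [← asIso_inv]; infer_instance
  -- `α x ≫ u⁻¹`-bookkeeping: `u⁻¹ ≫ α x = α″ x ≫ u⁻¹`
  have hu' : ∀ x, inv u ≫ α x = α'' x ≫ inv u := fun x => by
    rw [IsIso.inv_comp_eq, ← Category.assoc, ← hu x, Category.assoc, IsIso.hom_inv_id, Category.comp_id]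
  refine ⟨⟨inferInstance, ?_⟩, fun T t => ?_, fun x => ?_⟩
  · rw [Over.comp_left]
    infer_instance
  · -- kernel property: test `t ≫ u` against the pin on `A″`
    have key : (∀ x ∈ 𝔭, t ≫ α x = 1) ↔ ∀ x ∈ 𝔭, (t ≫ u) ≫ α'' x = 1 := by
      refine forall₂_congr fun x _ => ?_
      rw [Category.assoc, ← hu x, ← Category.assoc]
      constructor
      · intro h
        rw [h, MonObj.one_comp]
      · intro h
        have h' := congrArg (· ≫ inv u) h
        simp only [Category.assoc, IsIso.hom_inv_id, Category.comp_id] at h'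
        rw [h', MonObj.one_comp]
    rw [key, hkerA'' (t ≫ u)]
    constructor
    · rintro ⟨s, hs⟩
      exact ⟨s, by rw [← Category.assoc, hs, Category.assoc, IsIso.hom_inv_id, Category.comp_id]⟩
    · rintro ⟨s, hs⟩
      exact ⟨s, by rw [← hs, Category.assoc, Category.assoc, IsIso.inv_hom_id, Category.comp_id]⟩
  · rw [← Category.assoc, hβA'' x, Category.assoc, Category.assoc, hu' x]

/-- **THE LAYER ISO ALONG A SERRE COVER, SOURCE PINNED THROUGH AN EQUIVARIANT ISOMORPHISM (one `obtain`; the L2 `stub_LAYERISO` shape).**  As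
`exists_layerIso_of_serreCover`, but the pin on the cover՚s source `A` is replaced by an equivariant isomorphism `u : A ⟶ A″` (`IsIso u`) to a group scheme `A″` carrying a
pin `ιA″ : GA″ ↪ A″`; conclusion: `φ : GC ≅ GA″`, homomorphisms and equivariances both ways, with `φ.hom ≫ ιA″ = ιC ≫ ψ′ ≫ u`.
(L2: `A = (univ ⊗ 𝔟)_{x̄}`, `C = univ_{x̄}`, `A″ = univ_{x̄″}`, `u = ū`, the two docks՚ pins and `hrkG₀` rows ⇒ `G₀(x̄) ≅ G₀(x̄″)`.)
[cite: MumfordAV1970, §7 Thm. 4 (p. 72)] [cite: Tate1997FiniteFlatGroupSchemes, (1.6)–(1.7) p. 122, (3.7)] [cite: Conrad2004GrossZagier, §7 (Thm. 7.5)] -/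
theorem exists_layerIso_of_serreCover_of_iso {A C A'' GC GA'' : SchemeOver k} [GrpObj A] [GrpObj C] [GrpObj A''] [GrpObj GC] [GrpObj GA'']
    [IsAffine GC.left] [IsAffine GA''.left] [Module.Finite k (Alg GC)] [Module.Finite k (Alg GA'')] [IsFinite GC.hom] [IsFinite GA''.hom]
    (𝔭 𝔞 : σ) (α : O → (A ⟶ A)) (αC : O → (C ⟶ C)) (α'' : O → (A'' ⟶ A''))
    (hαhom : ∀ x, IsMonHom (α x)) (hChom : ∀ x, IsMonHom (αC x))
    (hαmul : ∀ x y, α (x * y) = α y ≫ α x)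
    (hCmul : ∀ x y, αC (x * y) = αC y ≫ αC x) (hCadd : ∀ x y, αC (x + y) = αC x * αC y) (hCone : αC 1 = 𝟙 C)
    (u : A ⟶ A'') [IsMonHom u] [IsIso u] (hu : ∀ x, α x ≫ u = u ≫ α'' x)
    (ιA'' : GA'' ⟶ A'') (hιA'' : IsMonHom ιA'' ∧ IsClosedImmersion ιA''.left)
    (hkerA'' : ∀ ⦃T : SchemeOver k⦄ (t : T ⟶ A''), (∀ x ∈ 𝔭, t ≫ α'' x = 1) ↔ ∃ s : T ⟶ GA'', s ≫ ιA'' = t)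
    (βA'' : O → (GA'' ⟶ GA'')) (hβA'' : ∀ x, βA'' x ≫ ιA'' = ιA'' ≫ α'' x)
    (ιC : GC ⟶ C) (hιC : IsMonHom ιC ∧ IsClosedImmersion ιC.left)
    (hkerC : ∀ ⦃T : SchemeOver k⦄ (t : T ⟶ C), (∀ x ∈ 𝔭, t ≫ αC x = 1) ↔ ∃ s : T ⟶ GC, s ≫ ιC = t)
    (βC : O → (GC ⟶ GC)) (hβC : ∀ x, βC x ≫ ιC = ιC ≫ αC x)
    (hrank : Module.finrank k (Alg GC) = Module.finrank k (Alg GA''))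
    (ψ : A ⟶ C) [IsMonHom ψ] [Flat ψ.left] [Surjective ψ.left] [QuasiCompact ψ.left] (hψ : ∀ x, α x ≫ ψ = ψ ≫ αC x)
    (hker : ∀ ⦃T : SchemeOver k⦄ (s : T ⟶ A), (∀ a' ∈ 𝔞, s ≫ α a' = 1) → s ≫ ψ = 1)
    {a r r' : O} (hr : ∀ a' ∈ 𝔞, ∃ x : O, a' * r = x * a) (hrr' : ∃ q ∈ 𝔭, r * r' = 1 + q)
    (ψ' : C ⟶ A) [IsMonHom ψ'] (hψ' : ∀ x, αC x ≫ ψ' = ψ' ≫ α x) (hψψ' : ψ ≫ ψ' = α a) :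
    ∃ φ : GC ≅ GA'', φ.hom ≫ ιA'' = ιC ≫ ψ' ≫ u ∧ IsMonHom φ.hom ∧ IsMonHom φ.inv ∧
      (∀ x, βC x ≫ φ.hom = φ.hom ≫ βA'' x) ∧ (∀ x, βA'' x ≫ φ.inv = φ.inv ≫ βC x) := by
  obtain ⟨hιA, hkerA, hβA⟩ := pin_transport_of_iso 𝔭 α α'' u hu ιA'' hιA'' hkerA'' βA'' hβA''
  obtain ⟨φ, hφ, hmon, hmon', hβφ, hβφ'⟩ :=
    exists_layerIso_of_serreCover 𝔭 𝔞 α αC hαhom hChom hαmul hCmul hCadd hCone (ιA'' ≫ inv u) ιC hιA hιC hkerA hkerC βA'' hβA βC hβC hrank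
      ψ hψ hker hr hrr' ψ' hψ' hψψ'
  refine ⟨φ, ?_, hmon, hmon', hβφ, hβφ'⟩
  rw [← Category.assoc (ιC), ← hφ, Category.assoc, Category.assoc, IsIso.inv_hom_id, Category.comp_id]

end Literature.AlgebraicGeometry.GroupSchemes.IdealKernelLayerIso

end
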